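import Summits.ABC.IUTFork.Cor312VolumesRealArch
import Summits.ABC.IUTFork.Thm311RealFullPrintArch
import HarnessLib

/-!
# [IUTchIII] Theorem 3.11 (i) (c) and the whole typed Theorem 3.11 at the real instantiation with HONEST volumes
# AT EVERY PLACE: probability weights at the primes, abc-iut-w5-d163's radial archimedean container at `∞`

Record file (D-0012) of the abc-iut cell (Cor. 3.12 sub-crew, seat abc-iut-c312-1 — the typer of [IUTchIII]
Thm. 3.11 —, gen 5); TAKES NO SIDE on [IUTchIII] Cor. 3.12. This seat's `Thm311RealDegree` (p417577) /
`Thm311RealDegreeFull` (p418191) / `Thm311RealFullPrintArch` (p419143) prove the degree clause (i) (c) and then the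
whole premise of record `Thm311.FullSituation.Statement` with no hypothesis at the real instantiation whose
`𝕄(−)`/`μ^log` is `Real.summandPiecesPr` — packet-normalised at the primes (probability weights `Pr(v⃗)`) but with
abc-iut-c312-5's TRIVIAL one-point container at `v_ℚ = ∞` (Dupuy–Hilado convention, log-volume `0`). Meanwhile
abc-iut-w5-d163 (`Cor312VolumesArchSummands`, `Cor312VolumesRealArch`) supplied the HONEST archimedean local pieces
under [IUTchI] Def. 3.1 (a) "`√−1 ∈ F`": the real archimedean packet `M_I = ⊗_{i,ℝ} ⊕_{v|∞} ℂ_v` of [IUTchIV]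
Prop. 1.5 (iii) with abc-iut-L5-t7's normalised packet log-volume (`B_I ↦ 0`, [IUTchIII] Prop. 3.9 (i) archimedean
case) — `Real.archPresentationDH`. THIS file puts the two together for the degree clause and the typed Theorem 3.11:

* `Real.localPiecesPrWith A` / `Real.summandPiecesPrWith A` — the probability-weighted real prime packets at every
  prime together with ANY archimedean local pieces `A` (generic combinator; `A :=` w5-d163's
  `(archPresentationDH X logv hc).toLocalPieces` in §3; abc-iut-w5-d043's announced `summandPiecesPrArch` is this
  instance), `generatorsPreserve_summandPiecesPrWith`;
* `Real.idealRegionWith R∞` — the region of a fractional ideal `𝔍`: the direct product regions of p417577 at the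
  primes, a given region `R∞ j` at `∞` (fractional ideals have no archimedean component: `R∞` is to be an integral
  structure of log-volume `0`);
* `Real.degreesViaLogvol_ofIdeals_with` — the degree clause HOLDS for every line realizing `summandPiecesPrWith A`
  as soon as `R∞ j` is admissible with log-volume `0` at `∞` (the prime computation is p417577's, unchanged);
* §3, `A :=` w5-d163's archimedean pieces, `R∞ j := e⁻¹(B_I)` the pull-back of the integral structure `B_I` of
  `M_I` (admissible: positive finite volume, w5-d163 `adm_smul_ball`; log-volume `0`: L5-t7 `packetLogVol_ball`):
  `Real.degreeClause_situationPrArch` and **`Real.full_statement_honest`** — `Thm311.FullSituation.Statement` with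
  NO hypothesis beyond "`√−1 ∈ F`" (`hc : ∀ w, w.IsComplex`, w5-d163 `isComplex_of_sqrt_neg_one`) at the real
  instantiation carrying: honest log-volumes at EVERY place (Pr-weighted `log μ̄` at `p`, radial `M_I`-volume at
  `∞`), print's archimedean integral structure `archPkPrint` and print's single-place (Ind3)-images (p419143), the
  LGP splitting monoids, (c) by fractional ideals, (iii)-objects over any L6 glue.

HONEST FRAMING: a measurement of the typing at the real carriers (ADJUDICATION-SPEC §3 (b)); every caveat of the
gen-5 measurement («trivial archimedean container / structure», «all-places images», «constant weights») is now
removed; nothing here bears on the truth of [IUTchIII] Thm. 3.11 / Cor. 3.12 (LANA Rem. 8.2.1: the content sits in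
the constructions the strictified typing identifies). Sources: [IUTchIII] kurims `paper:url-4b091feeb646` p. 94,
p. 115–117, p. 154; [IUTchIV] Prop. 1.5 (iii) / Step (vii) p. 30 (via w5-d163 / L5-t7). [claim: Mochizuki2012,
status: disputed] [cite: DupuyHilado2025, §3.6, Def. 3.6.1]. No file of another seat is edited. typed ≠ proved.
-/

noncomputable section

open Set Function NumberField IsDedekindDomain

/-! ## 0. Two facts about the integral structure `B_I` of w5-d163's archimedean summand -/

namespace Summit.ABC.IUTFork.Cor312Vol.ArchPresentation

open Literature.IUT.LogVolume.Prop15iii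
open scoped Pointwise

variable {T : Thm311.ThetaIndex} (vQ : T.VQ)

/-- `B_I` is admissible in `M_I` (`= 1·B_I`; w5-d163 `adm_smul_ball`). [folklore] -/
theorem adm_ball (j : T.Label) : adm vQ j (ball (Φ₀ vQ j)) := by
  letI : Fintype (T.Fibre vQ) := fibreFintype vQ
  simpa only [one_smul] using adm_smul_ball (vQ := vQ) j one_pos

/-- "The log-volume of `B_I` is equal to `0`" ([IUTchIV] Step (vii) p. 30; abc-iut-L5-t7 `packetLogVol_ball`), for
w5-d163's log-measure `logμ`. [claim: Mochizuki2012, status: disputed] -/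
theorem logμ_ball (j : T.Label) : logμ vQ j (ball (Φ₀ vQ j)) = 0 := by
  letI : Fintype (T.Fibre vQ) := fibreFintype vQ
  exact packetLogVol_ball _

end Summit.ABC.IUTFork.Cor312Vol.ArchPresentation

namespace Summit.ABC.IUTFork.Thm311.Real

open Cor312Vol CategoryTheory Literature.IUT.LogThetaLattice Literature.IUT.LogVolume
  Literature.IUT.LogVolume.Prop15iii Literature.NumberTheory.NumberFields

variable {F : Type} [Field F] [NumberField F] (X : PilotData F) {logv : PadicLogs F}

/-! ## 1. Probability weights at the primes, any local pieces at `∞` -/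

/-- **The real local pieces with probability weights at the primes and GIVEN archimedean pieces `A`** (the
combinator behind w5-d043's announced `summandPiecesPrArch`; `A := LocalPieces.trivial` recovers
`Real.localPiecesPr` pointwise). [claim: Mochizuki2012, status: disputed] -/
def localPiecesPrWith (A : LocalPieces (logShellsDH X logv) (infty X)) (hlog : LogvAnalytic logv) :
    ∀ vQ : (thetaIndex X).VQ, LocalPieces (logShellsDH X logv) vQ
  | .inl _ => A
  | .inr pp => haveI : Fact (pp : ℕ).Prime := ⟨pp.2⟩; (padicPresentationPr X pp.1 logv (hlog pp)).toLocalPieces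

/-- The assembled container: Pr-weighted real prime packets, archimedean pieces `A`. [claim: Mochizuki2012, status: disputed] -/
def summandPiecesPrWith (A : LocalPieces (logShellsDH X logv) (infty X)) (hlog : LogvAnalytic logv) :
    SummandPieces (logShellsDH X logv) :=
  SummandPieces.ofLocal (localPiecesPrWith X A hlog)

/-- The generator hypotheses hold as soon as they hold for `A` (the primes: `generatorsPreservePr`).
[cite: DupuyHilado2025, §4.7, §4.9] -/
theorem generatorsPreserve_summandPiecesPrWith {A : LocalPieces (logShellsDH X logv) (infty X)}
    (hA : A.GeneratorsPreserve) (hlog : LogvAnalytic logv) : (summandPiecesPrWith X A hlog).GeneratorsPreserve :=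
  SummandPieces.generatorsPreserve_ofLocal _ fun vQ =>
    match vQ with
    | .inl u => by cases u; exact hA
    | .inr pp => by haveI : Fact (pp : ℕ).Prime := ⟨pp.2⟩; exact generatorsPreservePr X pp.1 logv (hlog pp)

/-! ## 2. The ideal region with a given archimedean component; the degree clause -/

section Degree

variable (A : LocalPieces (logShellsDH X logv) (infty X))
  (R : ∀ j : (thetaIndex X).Label, Set ((logShellsDH X logv).Packet j (infty X))) (hlog : LogvAnalytic logv)

/-- **The region of `Π_{v_ℚ} 𝓘^ℚ(^{S^±_{j+1}};𝒟^⊢_{v_ℚ})` determined by the fractional ideal `𝔍`**, archimedean component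
GIVEN: at a prime the direct product region of p417577 (`Real.idealRegion`), at `∞` the region `R j` (to be an
integral structure of log-volume `0`: fractional ideals of `𝕍(F)^non` carry no archimedean component).
[claim: Mochizuki2012, status: disputed] -/
def idealRegionWith (j : (thetaIndex X).Label) (J : HeightOneSpectrum (𝓞 F) →₀ ℤ) :
    ∀ vQ : (thetaIndex X).VQ, Set ((logShellsDH X logv).Packet j vQ)
  | .inl _ => R j
  | .inr pp => idealRegion X hlog j J (.inr pp)

variable {A R}

/-- Admissibility everywhere, given admissibility of `R j` in `A`. [folklore] -/
theorem adm_idealRegionWith (hadm : ∀ j, A.Adm j (R j)) (j : (thetaIndex X).Label)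
    (J : HeightOneSpectrum (𝓞 F) →₀ ℤ) (vQ : (thetaIndex X).VQ) :
    (summandPiecesPrWith X A hlog).Adm j vQ (idealRegionWith X R hlog j J vQ) := by
  rcases vQ with u | pp
  · cases u; exact hadm j
  · haveI : Fact (pp : ℕ).Prime := ⟨pp.2⟩
    exact (summandPiecesPrWith X A hlog).adm_preimage_pi j (.inr (ratPrime pp.1)) fun e =>
      idealBox_adm X pp.1 (hlog (ratPrime pp.1)) J e

/-- At a prime the log-volume is p417577's `(1/[F:ℚ])·Σ_{v|p} c_v·log|κ(v)|` (same pieces). [folklore] -/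
theorem logvol_idealRegionWith_inr (p : ℕ) [Fact p.Prime] (j : (thetaIndex X).Label)
    (J : HeightOneSpectrum (𝓞 F) →₀ ℤ) :
    (summandPiecesPrWith X A hlog).logvol j (.inr (ratPrime p)) (idealRegionWith X R hlog j J (.inr (ratPrime p))) =
      (∑ v ∈ placesOver F p, (J v : ℝ) * logNorm F v) / Module.finrank ℚ F :=
  logvol_idealRegion_inr X p hlog j J

open scoped Classical in
/-- The local log-volumes vanish off the primes under the support of `𝔍`, given log-volume `0` of `R j` at `∞`.
[claim: Mochizuki2012, status: disputed] -/
theorem support_logvol_idealRegionWith_subset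
    (hvol : ∀ j, (summandPiecesPrWith X A hlog).logvol j (infty X) (R j) = 0) (j : (thetaIndex X).Label)
    (J : HeightOneSpectrum (𝓞 F) →₀ ℤ) :
    (Function.support fun vQ : (thetaIndex X).VQ =>
        (summandPiecesPrWith X A hlog).logvol j vQ (idealRegionWith X R hlog j J vQ)) ⊆
      ↑(J.support.image fun v => (thetaIndex X).over (.inr v : Place F)) := by
  intro vQ hvQ
  rw [Function.mem_support] at hvQ
  rcases vQ with u | pp
  · cases u; exact absurd (hvol j) hvQ
  · haveI : Fact (pp : ℕ).Prime := ⟨pp.2⟩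
    have h := logvol_idealRegionWith_inr X hlog (A := A) (R := R) pp.1 j J
    rw [show ratPrime pp.1 = pp from rfl] at h
    rw [h] at hvQ
    obtain ⟨v, hv, hJv⟩ : ∃ v ∈ placesOver F pp.1, (J v : ℝ) * logNorm F v ≠ 0 := by
      by_contra hcon
      simp only [not_exists, not_and, not_not] at hcon
      exact hvQ (by rw [Finset.sum_eq_zero hcon, zero_div])
    rw [Finset.coe_image, Set.mem_image]
    refine ⟨v, Finset.mem_coe.mpr (Finsupp.mem_support_iff.mpr fun h0 => hJv (by simp [h0])), ?_⟩
    rw [over_inr_eq]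
    exact congrArg Sum.inr (Subtype.ext ((mem_placesOver_iff_residueChar v).mp hv))

/-- The global log-volume is the normalised degree (prime by prime as in p417577; `0` at `∞`).
[claim: Mochizuki2012, status: disputed] -/
theorem finsum_logvol_idealRegionWith
    (hvol : ∀ j, (summandPiecesPrWith X A hlog).logvol j (infty X) (R j) = 0) (j : (thetaIndex X).Label)
    (J : HeightOneSpectrum (𝓞 F) →₀ ℤ) :
    ∑ᶠ vQ : (thetaIndex X).VQ, (summandPiecesPrWith X A hlog).logvol j vQ (idealRegionWith X R hlog j J vQ) =
      (J.sum fun v c => (c : ℝ) * logNorm F v) / Module.finrank ℚ F := by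
  classical
  rw [finsum_eq_sum_of_support_subset _ (support_logvol_idealRegionWith_subset X hlog hvol j J)]
  have hterm : ∀ vQ ∈ J.support.image fun v => (thetaIndex X).over (.inr v : Place F),
      (summandPiecesPrWith X A hlog).logvol j vQ (idealRegionWith X R hlog j J vQ) =
        (∑ v ∈ J.support with (thetaIndex X).over (.inr v : Place F) = vQ, (J v : ℝ) * logNorm F v) /
          Module.finrank ℚ F := by
    intro vQ hvQ
    obtain ⟨v₀, -, rfl⟩ := Finset.mem_image.mp hvQ
    haveI : Fact (residueChar F v₀).Prime := ⟨residueChar_prime F v₀⟩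
    have h := logvol_idealRegionWith_inr X hlog (A := A) (R := R) (residueChar F v₀) j J
    rw [show (Sum.inr (ratPrime (residueChar F v₀)) : (thetaIndex X).VQ) =
      (thetaIndex X).over (.inr v₀ : Place F) from rfl] at h
    rw [h]
    congr 1
    symm
    apply Finset.sum_subset
    · intro v hv
      rw [Finset.mem_filter] at hv
      have h1 := hv.2
      rw [over_inr_eq, over_inr_eq] at h1
      exact (mem_placesOver_iff_residueChar v).mpr (congrArg Subtype.val (Sum.inr.inj h1))
    · intro v hv hv'
      rw [Finset.mem_filter, not_and'] at hv'
      have hres : (thetaIndex X).over (.inr v : Place F) = (thetaIndex X).over (.inr v₀ : Place F) := by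
        rw [over_inr_eq, over_inr_eq]
        exact congrArg Sum.inr (Subtype.ext ((mem_placesOver_iff_residueChar v).mp hv))
      have hJ : J v = 0 := Finsupp.notMem_support_iff.mp (hv' hres)
      simp [hJ]
  rw [Finset.sum_congr rfl hterm, ← Finset.sum_div, Finset.sum_fiberwise_of_maps_to
    (g := fun v => (thetaIndex X).over (.inr v : Place F))
    (fun v hv => Finset.mem_image_of_mem (fun v => (thetaIndex X).over (.inr v : Place F)) hv), Finsupp.sum]

/-- **THE DEGREE CLAUSE for the Pr-weighted primes with ANY archimedean pieces**: for every line realizing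
`summandPiecesPrWith A`, this seat's typed `DegreesViaLogvol` holds for (c) by fractional ideals with the regions
`idealRegionWith R`, as soon as each `R j` is admissible in `A` with log-volume `0`. [claim: Mochizuki2012, status: disputed] -/
theorem degreesViaLogvol_ofIdeals_with (hadm : ∀ j, A.Adm j (R j))
    (hvol : ∀ j, (summandPiecesPrWith X A hlog).logvol j (infty X) (R j) = 0)
    {D : MRData (logShellsDH X logv)} (hD : (summandPiecesPrWith X A hlog).Realizes D) :
    DegreesViaLogvol D fun j => GlobalDegrees.ofIdeals (logShellsDH X logv) F j (idealRegionWith X R hlog j.1) := by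
  intro j J
  refine ⟨fun vQ => (hD.adm_iff _ _ _).2 (adm_idealRegionWith X hlog hadm j.1 J vQ), ?_, ?_⟩
  · show {vQ | D.logvol j.1 vQ (idealRegionWith X R hlog j.1 J vQ) ≠ 0}.Finite
    simp_rw [hD.logvol_eq]
    classical
    exact (Finset.finite_toSet _).subset (support_logvol_idealRegionWith_subset X hlog hvol j.1 J)
  · show (GlobalDegrees.ofIdeals (logShellsDH X logv) F j (idealRegionWith X R hlog j.1)).deg J =
      ∑ᶠ vQ, D.logvol j.1 vQ (idealRegionWith X R hlog j.1 J vQ)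
    simp_rw [hD.logvol_eq]
    rw [finsum_logvol_idealRegionWith X hlog hvol, GlobalDegrees.ofIdeals_deg]

end Degree

/-! ## 3. The honest archimedean pieces of abc-iut-w5-d163: `R j := e⁻¹(B_I)` -/

section Honest

variable (hlog : LogvAnalytic logv) (hc : ∀ w : InfinitePlace F, w.IsComplex)

/-- **The archimedean component of the ideal region: the pull-back `e⁻¹(B_I)` of the integral structure of
`M_I`** ([IUTchIV] Prop. 1.5 (iii) / Step (vii) p. 30 "the log-volume of `B_I` is equal to `0`"; w5-d163's
comparison `e`, L5-t7's `ball Φ₀`). [claim: Mochizuki2012, status: disputed] -/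
def archUnitRegion (j : (thetaIndex X).Label) : Set ((logShellsDH X logv).Packet j (infty X)) :=
  (archPresentationDH X logv hc).comparison j ⁻¹' ball (ArchPresentation.Φ₀ (T := thetaIndex X) (Sum.inl ()) j)

/-- `e⁻¹(B_I)` is admissible in the honest archimedean pieces (w5-d163 `adm_preimage_of_adm`). [folklore] -/
theorem adm_archUnitRegion (j : (thetaIndex X).Label) :
    (archPresentationDH X logv hc).toLocalPieces.Adm j (archUnitRegion X hc j) :=
  (archPresentationDH X logv hc).adm_preimage_of_adm j (ArchPresentation.adm_ball _ j)

/-- **`e⁻¹(B_I)` has log-volume `0`** in the assembled container (one summand of weight `1`, L5-t7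
`packetLogVol_ball`). [claim: Mochizuki2012, status: disputed] -/
theorem logvol_archUnitRegion (j : (thetaIndex X).Label) :
    (summandPiecesPrWith X (archPresentationDH X logv hc).toLocalPieces hlog).logvol j (infty X)
      (archUnitRegion X hc j) = 0 := by
  rw [SummandPieces.logvol_eq_of_pi (R := fun _ : Unit => _)
    ((archPresentationDH X logv hc).e_image_preimage j _) (fun _ => ArchPresentation.adm_ball _ j)]
  show ∑ _u : Unit, (1 : ℝ) * ArchPresentation.logμ (T := thetaIndex X) (Sum.inl ()) j _ = _
  rw [Fintype.sum_unique, one_mul]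
  exact ArchPresentation.logμ_ball _ j

/-- **The generator hypotheses hold for the every-place-honest Pr-weighted container** (w5-d163
`generatorsPreserveDHArch` at `∞`, `generatorsPreservePr` at the primes). [cite: DupuyHilado2025, §4.7, §4.9] -/
theorem generatorsPreserve_summandPiecesPrArchHonest :
    (summandPiecesPrWith X (archPresentationDH X logv hc).toLocalPieces hlog).GeneratorsPreserve :=
  generatorsPreserve_summandPiecesPrWith X (generatorsPreserveDHArch X logv hc) hlog

variable (archPk : ∀ (j : (thetaIndex X).Label) (vQ : (thetaIndex X).VQ), Set ((logShellsDH X logv).Packet j vQ))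
  (archSub : ∀ (j : (thetaIndex X).Label) (v : (thetaIndex X).V),
    Set ((logShellsDH X logv).Packet j ((thetaIndex X).over v)))
  (Ψ : ℤ → ∀ v : (thetaIndex X).V, v ∈ (thetaIndex X).Vbad → Set ((logShellsDH X logv).StarPacket v))
  (act : ℤ → ∀ v : (thetaIndex X).V, v ∈ (thetaIndex X).Vbad →
    (logShellsDH X logv).StarPacket v → Module.End ℚ ((logShellsDH X logv).StarPacket v))
  (Mmod : ℤ → ∀ j : (thetaIndex X).LabelStar, Set ((logShellsDH X logv).GlobalPacket j.1))
  (region : ℤ → ∀ j : (thetaIndex X).LabelStar, FinDivisor F → ∀ vQ : (thetaIndex X).VQ,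
    Set ((logShellsDH X logv).Packet j.1 vQ))

/-- **[IUTchIII] Thm. 3.11 (i) (c) HOLDS at the real instantiation with honest volumes at every place**: c312-5's
`Situation.ofShells` over `logShellsDH X logv` with `Adm`/`logvol` := the Pr-weighted primes ⊕ w5-d163's
archimedean pieces, `G` := fractional ideals with the regions `idealRegionWith archUnitRegion` — for every choice
of the remaining binders. [claim: Mochizuki2012, status: disputed] -/
theorem degreeClause_situationPrArch :
    ({ Situation.ofShells (logShellsDH X logv) F archPk archSub
          (summandPiecesPrWith X (archPresentationDH X logv hc).toLocalPieces hlog).Adm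
          (summandPiecesPrWith X (archPresentationDH X logv hc).toLocalPieces hlog).logvol Ψ act Mmod region with
        G := fun _ j => GlobalDegrees.ofIdeals (logShellsDH X logv) F j
          (idealRegionWith X (archUnitRegion X hc) hlog j.1) } : Situation (thetaIndex X)).DegreeClause := fun _ =>
  degreesViaLogvol_ofIdeals_with X hlog (adm_archUnitRegion X hc) (logvol_archUnitRegion X hlog hc)
    ⟨fun _ _ _ => Iff.rfl, fun _ _ _ => rfl⟩

end Honest

/-! ## 4. The whole typed Theorem 3.11: honest volumes everywhere, print's archimedean structure, single-place images -/

section Full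

variable [Fintype (ArchFibre X)] (hc : ∀ w : InfinitePlace F, w.IsComplex)
  (archSub₀ : ∀ (j : (thetaIndex X).Label) (v : (thetaIndex X).V),
    Set ((logShellsDH X (analyticLogv F)).Packet j ((thetaIndex X).over v)))
  (act₀ : ∀ v : (thetaIndex X).V, v ∈ (thetaIndex X).Vbad →
    (logShellsDH X (analyticLogv F)).StarPacket v → Module.End ℚ ((logShellsDH X (analyticLogv F)).StarPacket v))
  (Mmod₀ : ∀ j : (thetaIndex X).LabelStar, Set ((logShellsDH X (analyticLogv F)).GlobalPacket j.1))
  (region₀ : ℤ → ∀ j : (thetaIndex X).LabelStar, FinDivisor F → ∀ vQ : (thetaIndex X).VQ,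
    Set ((logShellsDH X (analyticLogv F)).Packet j.1 vQ))
  (thetaDiv₀ : ℤ → ℤ → LgpDivisor F (thetaIndex X).lstar)
  {S : StripFrame.{0}} (G : LatticeGlue S) (Λ : LogThetaLatticeDiagram G.logData G.linkData)
  {Kap : Type} [Category.{0} Kap] (FM : Core S.DHT ⥤ Kap)

/-- **THE TYPED THEOREM 3.11 HOLDS OUTRIGHT at the real instantiation with HONEST volumes at EVERY place,
print's archimedean integral structure and print's single-place (Ind3)-images** — under [IUTchI] Def. 3.1 (a)
"`√−1 ∈ F`" only (`hc`; w5-d163 `isComplex_of_sqrt_neg_one`). Instantiation: analytic logarithms; c312-5's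
`logShellsDH`; `𝕄(−)`/`μ^log` := `summandPiecesPrWith (archPresentationDH …).toLocalPieces` (Pr-weighted `log μ̄` at
the primes, the radial `M_I`-volume at `∞`); (a)'s archimedean structure := print's Hermitian ball (`archPkPrint`,
p419143); (b) := the LGP splitting monoids (any `qroot`, `ζ`); (c) := fractional ideals with the regions
`idealRegionWith archUnitRegion`; coric strictified columns with print's single-place images of w4-d029's honest
iterate images / of the shells; any Θ-pilot lgp-divisors; (iii)-objects over any L6 glue. A measurement of the
typing; no side taken. [claim: Mochizuki2012, status: disputed] -/
theorem full_statement_honest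
    (qroot : ∀ v : HeightOneSpectrum (𝓞 F), Carrier (.inr v : Place F))
    (ζ : ∀ v : HeightOneSpectrum (𝓞 F), (thetaIndex X).LabelStar → (Carrier (.inr v : Place F))ˣ) :
    Summit.ABC.IUTFork.Thm311.FullSituation.Statement
      ({ LatticeSituation.ofShells (logShellsDH X (analyticLogv F)) F
            (archPkPrint X (analyticLogv F) stripAutDH (ismDH (analyticLogv F)) refl_mem_stripAutDH
              (refl_mem_ismDH (analyticLogv F)))
            archSub₀
            (summandPiecesPrWith X (archPresentationDH X (analyticLogv F) hc).toLocalPieces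
              (logvAnalytic_analyticLogv (F := F))).Adm
            (summandPiecesPrWith X (archPresentationDH X (analyticLogv F) hc).toLocalPieces
              (logvAnalytic_analyticLogv (F := F))).logvol
            (fun _ x _ => match x with
              | .inr v => splittingMonoidLGP X (analyticLogv F) stripAutDH (ismDH (analyticLogv F))
                  refl_mem_stripAutDH (refl_mem_ismDH (analyticLogv F)) v (qroot v) (ζ v)
              | .inl _ => ∅)
            (fun _ => act₀) (fun _ => Mmod₀) region₀
            (fun _ _ => (summandPiecesPrWith X (archPresentationDH X (analyticLogv F) hc).toLocalPieces
              (logvAnalytic_analyticLogv (F := F))).Adm)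
            (fun _ _ => (summandPiecesPrWith X (archPresentationDH X (analyticLogv F) hc).toLocalPieces
              (logvAnalytic_analyticLogv (F := F))).logvol)
            (fun _ _ x _ => match x with
              | .inr v => splittingMonoidLGP X (analyticLogv F) stripAutDH (ismDH (analyticLogv F))
                  refl_mem_stripAutDH (refl_mem_ismDH (analyticLogv F)) v (qroot v) (ζ v)
              | .inl _ => ∅)
            (fun _ _ => Mmod₀)
            (fun _ _ m' j vQ =>
              (logShellsDH X (analyticLogv F)).tprodSingleImages j vQ fun v => iterImage (analyticLogv F) m' v.1)
            (fun _ _ j vQ =>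
              (logShellsDH X (analyticLogv F)).tprodSingleImages j vQ fun v => shell (analyticLogv F) v.1)
            thetaDiv₀ with
          G := fun _ j => GlobalDegrees.ofIdeals (logShellsDH X (analyticLogv F)) F j
            (idealRegionWith X (archUnitRegion X hc) (logvAnalytic_analyticLogv (F := F)) j.1)
          link := LinkData.ofGlueRadial G Λ FM } : FullSituation (thetaIndex X)) := by
  refine (FullSituation.statement_ofGlueRadial_iff_clauses
    ({ LatticeSituation.ofShells (logShellsDH X (analyticLogv F)) F
          (archPkPrint X (analyticLogv F) stripAutDH (ismDH (analyticLogv F)) refl_mem_stripAutDH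
            (refl_mem_ismDH (analyticLogv F)))
          archSub₀
          (summandPiecesPrWith X (archPresentationDH X (analyticLogv F) hc).toLocalPieces
            (logvAnalytic_analyticLogv (F := F))).Adm
          (summandPiecesPrWith X (archPresentationDH X (analyticLogv F) hc).toLocalPieces
            (logvAnalytic_analyticLogv (F := F))).logvol
          (fun _ x _ => match x with
            | .inr v => splittingMonoidLGP X (analyticLogv F) stripAutDH (ismDH (analyticLogv F))
                refl_mem_stripAutDH (refl_mem_ismDH (analyticLogv F)) v (qroot v) (ζ v)
            | .inl _ => ∅)
          (fun _ => act₀) (fun _ => Mmod₀) region₀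
          (fun _ _ => (summandPiecesPrWith X (archPresentationDH X (analyticLogv F) hc).toLocalPieces
            (logvAnalytic_analyticLogv (F := F))).Adm)
          (fun _ _ => (summandPiecesPrWith X (archPresentationDH X (analyticLogv F) hc).toLocalPieces
            (logvAnalytic_analyticLogv (F := F))).logvol)
          (fun _ _ x _ => match x with
            | .inr v => splittingMonoidLGP X (analyticLogv F) stripAutDH (ismDH (analyticLogv F))
                refl_mem_stripAutDH (refl_mem_ismDH (analyticLogv F)) v (qroot v) (ζ v)
            | .inl _ => ∅)
          (fun _ _ => Mmod₀)
          (fun _ _ m' j vQ =>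
            (logShellsDH X (analyticLogv F)).tprodSingleImages j vQ fun v => iterImage (analyticLogv F) m' v.1)
          (fun _ _ j vQ =>
            (logShellsDH X (analyticLogv F)).tprodSingleImages j vQ fun v => shell (analyticLogv F) v.1)
          thetaDiv₀ with
        G := fun _ j => GlobalDegrees.ofIdeals (logShellsDH X (analyticLogv F)) F j
          (idealRegionWith X (archUnitRegion X hc) (logvAnalytic_analyticLogv (F := F)) j.1) } :
      LatticeSituation (thetaIndex X))
    G Λ FM).mpr ⟨⟨?_, ?_, fun _ _ => rfl⟩, ?_⟩
  · -- (i) (b): the LGP splitting monoids sit in the sub-packets (c312-5)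
    exact fun _ => psiInSubPackets_ofShells_of_LGP X (analyticLogv F) stripAutDH (ismDH (analyticLogv F))
      refl_mem_stripAutDH (refl_mem_ismDH (analyticLogv F)) _ archSub₀ _ _ _ act₀ Mmod₀ qroot ζ fun _ _ => rfl
  · -- (i) (c): the degree clause with honest volumes at every place (§3)
    exact degreeClause_situationPrArch X (logvAnalytic_analyticLogv (F := F)) hc _ archSub₀ _ (fun _ => act₀)
      (fun _ => Mmod₀) region₀
  · -- (ii): print's single-place images against print's structures (p419143)
    exact partII_ofShells_singleImages_print X (analyticLogv F) stripAutDH (ismDH (analyticLogv F))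
      refl_mem_stripAutDH (refl_mem_ismDH (analyticLogv F)) archSub₀ _ _ _ (fun _ => act₀) (fun _ => Mmod₀)
      region₀ thetaDiv₀ (logvLaw_analyticLogv F)

end Full

end Summit.ABC.IUTFork.Thm311.Real

end
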